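/-
Copyright (c) 2026 the pub-hodgecm-mathlib formalisation cell (harness21).  Prover seat hodgecm-mathlib-F0P3a-p01 (g38), explicit-unit SUPPORTS-ONLY on h413, req620 Track A
«(D-RAM) FOUR-FRAME» squad ((β₂) road (R-36) «PURE-CELL LEDGER», lane A (Unr-K), (OFF-A) ED. 5: three of the seven sockets of ED. 4 PAID BY NAME with the ★ type-free payers of lane B —
lane-A analogue of LH4-p12 (g8)'s ★ `…OffRowOfPiecesResidual`, without the parity gate and without a diagonal socket), 2026-09-05.
-/
import Summits.HodgeConjecture.HodgeConjecture.Theorems.F0P3cDyRamBeta2ConesOffRowAOfPiecesParity   -- ★ p863163 (this seat): ED. 4 `cellDiff_offRow_eq_zero_of_pieces₄` (the parity-aware dispatch)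
import Summits.HodgeConjecture.HodgeConjecture.Theorems.F0P3cDyRamConeCellPresentationLevel        -- ★ p863162 (this seat): `levelSetDep_inter_shell_eq_empty_of_deep_level ∕ _of_antidiagonal_one`
import Summits.HodgeConjecture.HodgeConjecture.Theorems.F0P3cDyRamTopConeCellMid                   -- ★ (LH4-p13 (g9)): the GENERAL top-line head `cellDiff_top_eq_zero` (`2m < m_c + 2b`)
import HarnessLib

/-!
# Crux `H413`, line LH4 «(D-RAM) FOUR-FRAME» — (β₂) road, lane A (Unr-K): «(OFF-A) FROM ITS PIECES», ED. 5 — ONLY THE BALANCED LINES ARE LEFT (+ the odd-row band)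
# `cellDiff_offRowA_eq_zero_of_pieces₅ (N) ⟨OFF-A.letter.v1 binders⟩ (hmcm : m_c ≤ m) (hL) (hOddRow) (hUlo) : ‹OFF-A.letter.v1 (199eeab2) body VERBATIM›`

Cell `hodgecm-mathlib` (D-0151), FLOOR 0, crux item H413 = `stmt-HodgeConjecture-24833`, route `HCCMUnconditional`; squad F0∕P3c∕LH4; lane `--supports stmt-HodgeConjecture-24833 --as helper`
(count-neutral; pays NO tier-0 row).  THEOREMS ONLY (no `def`, no instance, no notation, default heartbeats); ★-only imports; states NO law; the sockets, (OFF-A), (ROW-A), (β₂) stay HYPOTHESES.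
WHAT.  ED. 4 `cellDiff_offRowA_eq_zero_of_pieces₄` (this seat) with FOUR sockets DISCHARGED INSIDE by the type-free ★ payers LH4-p12 (g8)'s lane-B ED. 5 uses:
`hDeep` ← ★ `…ConeCellPresentationLevel.levelSetDep_inter_shell_eq_empty_of_deep_level` at both shells (`ℓ₀ = d % 2`, `hum` at `m*`, `ℓ₀ + 1 ≤ m*` from the datum); `hL0` ← ★
`…_of_antidiagonal_one`; `hUhi`, `hUmid` ← ★ `…TopConeCellMid.cellDiff_top_eq_zero` (LH4-p13 (g9); `m* ≤ m_c`, fence `m_c ≤ m`).  NO parity gate (lane A has none; none is needed: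
the ED. 4-A dispatch reads `m < 2b` from the cut), NO diagonal socket (empty in Unr-K).  Remaining sockets = **`hL` (lower line `j + b + ℓ₀ = jl`), `hUlo` (upper line, band
`m_c + 2b ≤ 2m`), `hOddRow` (odd `d`, `2b + 1 = m`, `j + b ≤ jl`)** — the BALANCED populated cells of the Unr-K census (cdis1 UNRK-LEDGER v2 ∕ E2B-LEDGER v1 (4); F0P3-p01 (U-Σ) SHAPE v1):
lane A's ‹OFF-A› is now «two balanced lines + the odd-row band».  The λ-wrapper `offRowA_holds (N) (hN : ∀ d tE q, mcOfRecord d ≤ N d tE q) (hL) (hOddRow) (hUlo) : ‹OFF-A.letter.v1›`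
(β₂ WORD #19 (2) N-discipline) is the next file, once the three sockets have payers.
HONEST LABEL.  Count-neutral dispatch; nothing printed is asserted; no census law is stated; the three sockets, (OFF-A), (ROW-A) and (β₂) stay HYPOTHESES (β₂ UNPROVED — witness-true on
the engine rows); `HC_CM` is proved only modulo the 7 printed citations (2 remaining named inputs: hLiu418 = `stmt-HodgeConjecture-24832`, h413 = `stmt-HodgeConjecture-24833`) until rung 0 closes.
## References
* [Kottwitz1986BaseChangeUnits] R. E. Kottwitz, *Base change for unit elements of Hecke algebras*, Compositio Math. 60 (1986): §1 pp. 240–241 (signed lattice counts, cell by cell).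
* [Jacobowitz1962] R. Jacobowitz, *Hermitian forms over local fields*, Amer. J. Math. 84 (1962): §4 (hermitian lattices over orders).
* [BruhatTits1972] F. Bruhat, J. Tits, *Groupes réductifs sur un corps local I*, Publ. Math. IHÉS 41 (1972): §10 (the tube around an axis of the tree).
-/

set_option autoImplicit false

noncomputable section

namespace Summit.HodgeConjecture.HodgeConjecture.Cruxes.H413.F0P3cDyRamBeta2ConesOffRowAOfPiecesResidual

open scoped Valued WithZero Matrix MatrixGroups Pointwise Classical
open WithZero
open Literature.NumberTheory.Automorphic Literature.NumberTheory.Automorphic.HermitianLattice Literature.NumberTheory.Automorphic.UnitaryLatticeTree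
open Literature.NumberTheory.Automorphic.UnitaryThreeFourFrame (IsRamifiedQuadraticDatum)
open Literature.NumberTheory.Rogawski1990
open Summit.HodgeConjecture.HodgeConjecture.Cruxes.H413.F0P3cDyRamFourFramePieces
open Summit.HodgeConjecture.HodgeConjecture.Cruxes.H413.F0P3cDyRamFourFrameCensusDefs (LatticeInLevel LatticeNearTransvShell)
open Summit.HodgeConjecture.HodgeConjecture.Cruxes.H413.F0P3cDyRamStageOneBDefs (mcOfRecord mstarOfRecord_le_mcOfRecord)
open Summit.HodgeConjecture.HodgeConjecture.Cruxes.H413.F0P3cDyRamToricCensusDefs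
open Summit.HodgeConjecture.HodgeConjecture.Cruxes.H413.F0P3cDyRamBeta2ConesOffRowAOfPiecesParity (cellDiff_offRowA_eq_zero_of_pieces₄)
open Summit.HodgeConjecture.HodgeConjecture.Cruxes.H413.F0P3cDyRamConeCellPresentationLevel (levelSetDep_inter_shell_eq_empty_of_deep_level levelSetDep_inter_shell_eq_empty_of_antidiagonal_one)
open Summit.HodgeConjecture.HodgeConjecture.Cruxes.H413.F0P3cDyRamTopConeCellMid (cellDiff_top_eq_zero)

/-- **(OFF-A.v1) FROM ITS PIECES, ED. 5 — `hDeep`, `hL0`, `hUhi`, `hUmid` PAID BY NAME; residual sockets `hL`, `hOddRow`, `hUlo`.**  Binders: `N`, `OFF-A.letter.v1`'s block BYTE FOR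
BYTE, the fence letter `hmcm : mcOfRecord d ≤ m`, then the three sockets; conclusion = `OFF-A.letter.v1`'s body VERBATIM.  Proof = ED. 4-A with the four ★ folds (see the module docstring).
[cite: Kottwitz1986BaseChangeUnits, §1 pp. 240–241] [cite: Jacobowitz1962, §4] [cite: BruhatTits1972, §10] -/
theorem cellDiff_offRowA_eq_zero_of_pieces₅ (N : ℕ → ℕ → ℕ → ℕ)
    {E M : Type} [Field E] [Valued E ℤᵐ⁰] [CompleteSpace E] [IsDiscreteValuationRing 𝒪[E]] [Finite 𝓀[E]]
    [Field M] [Valued M ℤᵐ⁰] [CompleteSpace M] [IsDiscreteValuationRing 𝒪[M]] [Finite 𝓀[M]]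
    (σ : E →+* E) (ϖ : E) (d tE : ℕ) (_hD : IsRamifiedQuadraticDatum σ ϖ d tE) (_hσσ : ∀ a, σ (σ a) = a) (_h2 : ¬ IsUnit (2 : 𝒪[E]))
    (jE : E →+* M) (ρ Θ : M →+* M) (α lam : M)
    (_hρρ : ∀ z, ρ (ρ z) = z) (_hvρ : ∀ z, Valued.v (ρ z) = Valued.v z) (_hρj : ∀ a, ρ (jE a) = jE a)
    (_hjv : ∀ a, Valued.v (jE a) ≤ 1 ↔ Valued.v a ≤ 1) (_hjfix : ∀ z : M, ρ z = z ↔ ∃ a, jE a = z) (_hΘj : ∀ a, Θ (jE a) = jE (σ a))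
    (_hΘΘ : ∀ z, Θ (Θ z) = z) (_hΘρ : ∀ z, Θ (ρ z) = ρ (Θ z)) (_hvΘ : ∀ z, Valued.v (Θ z) = Valued.v z)
    (_hα : ρ α ≠ α) (_hα1 : Valued.v α ≤ 1) (_hint : ∀ z : M, Valued.v z ≤ 1 → Valued.v ((z - ρ z) / (α - ρ α)) ≤ 1)
    (_hΘlam : Θ lam * lam = 1) (_hvlam : Valued.v lam = 1) (_hbasis : ∀ z : M, ∃! pq : E × E, z = jE pq.1 + jE pq.2 * lam)
    (_hU : Valued.v (α - ρ α) = 1) (_hτ : Valued.v (ρ α - Θ α) < 1)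
    (_hσres : ∀ z : M, ρ z = z → Valued.v z ≤ 1 → Valued.v (Θ z - z) < 1)
    (_hjiso : ∀ a, Valued.v (jE a) = Valued.v a)
    (_hq : Nat.card 𝓀[M] = Nat.card 𝓀[E] ^ 2) (_hddE : Valued.v (jE ϖ - Θ (jE ϖ)) = Valued.v (jE ϖ) ^ d)
    (_hfixE : ∀ z : M, ρ z = z → Θ z = z → z ≠ 0 → ∃ n : ℤ, Valued.v z = WithZero.exp (2 * n)) (_h2M : Valued.v (2 : M) = Valued.v (jE ϖ) ^ tE) (_hjpow : ∀ (t : E) (n : ℤ), Valued.v (jE t) = Valued.v (jE ϖ) ^ n ↔ Valued.v t = Valued.v ϖ ^ n)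
    (_hEval : ∀ c : M, ρ c = c → c ≠ 0 → Valued.v c ≤ 1 → ∃ n : ℕ, Valued.v c = Valued.v (jE ϖ) ^ n)
    (_hϖmax : ∀ t : M, ρ t = t → Valued.v t < 1 → Valued.v t ≤ Valued.v (jE ϖ))
    (γ₂ : GL (Fin 2) E) (u : GL (Fin 1) E)
    (_hdet : (γ₂ : Matrix (Fin 2) (Fin 2) E).det * σ (γ₂ : Matrix (Fin 2) (Fin 2) E).det = 1)
    (_htr : (γ₂ : Matrix (Fin 2) (Fin 2) E).trace = (γ₂ : Matrix (Fin 2) (Fin 2) E).det * σ (γ₂ : Matrix (Fin 2) (Fin 2) E).trace)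
    (_hirr : ∀ x : E, x * x - (γ₂ : Matrix (Fin 2) (Fin 2) E).trace * x + (γ₂ : Matrix (Fin 2) (Fin 2) E).det ≠ 0)
    (_hlam2 : lam * lam = jE (γ₂ : Matrix (Fin 2) (Fin 2) E).trace * lam - jE (γ₂ : Matrix (Fin 2) (Fin 2) E).det)
    (_hρlam : ρ lam = jE (γ₂ : Matrix (Fin 2) (Fin 2) E).trace - lam) (m jl : ℕ) (_hm : Valued.v (lam - jE ((u : Matrix (Fin 1) (Fin 1) E) 0 0)) = WithZero.exp (-(m : ℤ)))
    (_hjl : Valued.v ((lam - jE ((u : Matrix (Fin 1) (Fin 1) E) 0 0)) - ρ (lam - jE ((u : Matrix (Fin 1) (Fin 1) E) 0 0))) = WithZero.exp (-(jl : ℤ)))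
    (_hs : Valued.v ((γ₂ : Matrix (Fin 2) (Fin 2) E).trace - 2) * Valued.v (ϖ ^ (d % 2)) ≤ Valued.v (ϖ ^ mcOfRecord d))
    (_hp : Valued.v ((γ₂ : Matrix (Fin 2) (Fin 2) E).det - (γ₂ : Matrix (Fin 2) (Fin 2) E).trace + 1) ≤ Valued.v (ϖ ^ mcOfRecord d))
    (_hNm : N d tE (Nat.card 𝓀[E]) ≤ m) (_hu1N : Valued.v (((u : Matrix (Fin 1) (Fin 1) E) 0 0) - 1) ≤ Valued.v (ϖ ^ N d tE (Nat.card 𝓀[E]))) (_hlam1 : Valued.v (lam - 1) ≤ Valued.v (jE ϖ ^ N d tE (Nat.card 𝓀[E])))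
    (_hu : Valued.v ((u : Matrix (Fin 1) (Fin 1) E) 0 0) = 1) (_hum : Valued.v (((u : Matrix (Fin 1) (Fin 1) E) 0 0) - 1) ≤ Valued.v (ϖ ^ mstarOfRecord d))
    (H₂ : Matrix (Fin 2) (Fin 2) E) (hW : E) (_hH₂ : IsUnit H₂.det) (_hH₂σ : (H₂.map σ)ᵀ = H₂) (_hhW : Valued.v hW = 1) (_hhWσ : σ hW = hW)
    (P₁ : GL (Fin 3) E) (_hA : formCongr σ P₁ ((StdForm.antidiagonal 3).over E) = (!![H₂ 0 0, 0, H₂ 0 1; 0, hW, 0; H₂ 1 0, 0, H₂ 1 1] : Matrix (Fin 3) (Fin 3) E))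
    (_hΓ : P₁ * endoGL (γ₂, u) * P₁⁻¹ ∈ unitaryGroupOfForm σ ((StdForm.antidiagonal 3).over E))
    (φ : (Fin 2 → E) →+ M) (h : M) (_hφs : ∀ (c : E) (x : Fin 2 → E), φ (c • x) = jE c * φ x) (_hφi : Function.Injective φ) (_hφo : Function.Surjective φ)
    (_hφγ : ∀ x, φ ((γ₂ : Matrix (Fin 2) (Fin 2) E).mulVec x) = lam * φ x)
    (_hform : ∀ x y, jE (pairing σ H₂ x y) = h * Θ (φ x) * φ y + ρ (h * Θ (φ x) * φ y)) (_hΘh : Θ h = h) (_hh : h ≠ 0)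
    (J R : ℕ) (f : ℕ → ℕ → AddSubgroup M → ℕ)
    (_hfinF : {L₃ : Submodule 𝒪[E] (Fin 3 → E) | IsSelfDualLattice σ ϖ (!![H₂ 0 0, 0, H₂ 0 1; 0, hW, 0; H₂ 1 0, 0, H₂ 1 1] : Matrix (Fin 3) (Fin 3) E) L₃ ∧ mapGL (endoGL (γ₂, u)) L₃ = L₃}.Finite)
    (_hR : ∀ L₃ : Submodule 𝒪[E] (Fin 3 → E), IsSelfDualLattice σ ϖ (!![H₂ 0 0, 0, H₂ 0 1; 0, hW, 0; H₂ 1 0, 0, H₂ 1 1] : Matrix (Fin 3) (Fin 3) E) L₃ →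
    mapGL (endoGL (γ₂, u)) L₃ = L₃ → ∀ b : ℕ, (∀ c : E, (Pi.single 1 c : Fin 3 → E) ∈ L₃ ↔ Valued.v c ≤ Valued.v ϖ ^ b) → b ≤ R)
    (_hJ : ¬ IsOrd ρ α (jE ϖ ^ (J + 1)) lam) (_hfinLS : ∀ j a, (levelSet ρ Θ α (jE ϖ) h j a).Finite)
    (_hf : ∀ (b j : ℕ) (Λ : AddSubgroup M) (x₀ : M) (r : E), 1 ≤ b → x₀ ≠ 0 → (∀ x, x ∈ Λ ↔ ∃ z, IsOrd ρ α (jE ϖ ^ j) z ∧ x = x₀ * z) →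
    IsOrd ρ α (jE ϖ ^ j) (dualGen ρ Θ α (jE ϖ ^ j) h x₀) → ¬ IsOrd ρ α (jE ϖ ^ j) (dualGen ρ Θ α (jE ϖ ^ j) h x₀ / jE ϖ) → Valued.v (dualGen ρ Θ α (jE ϖ ^ j) h x₀) = Valued.v (jE ϖ) ^ b →
    (∀ b', (∀ x ∈ Λ, Valued.v (h * Θ x * b' + ρ (h * Θ x * b')) ≤ 1) → (lam - jE ((u : Matrix (Fin 1) (Fin 1) E) 0 0)) * b' ∈ Λ) → IsOrd ρ α (jE ϖ ^ j) lam →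
    jE r = glueUnit ρ Θ α (jE ϖ ^ j) h (jE ϖ) (jE hW) x₀ b →
    f b j Λ = Nat.card {x : 𝒪[E] ⧸ 𝓂[E] ^ (2 * b) // ∃ u' : 𝒪[E], Ideal.Quotient.mk (𝓂[E] ^ (2 * b)) u' = x ∧ Valued.v ((u' : E) * σ u' - r) ≤ Valued.v (ϖ ^ (2 * b))})
    (hmcm : mcOfRecord d ≤ m)
    (hL : ∀ j b : ℕ, 1 ≤ b → b < j → 2 * b + d % 2 < m → j + b + d % 2 = jl → IsOrd ρ α (jE ϖ ^ j) lam →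
          ((∑ᶠ Λ ∈ levelSetDep ρ Θ α (jE ϖ) h j b (lam - jE ((u : Matrix (Fin 1) (Fin 1) E) 0 0)) ∩
          {Λ | ∃ B : Submodule 𝒪[E] (Fin 2 → E), B.toAddSubgroup.map φ = Λ ∧
          ∃ L₃ : Submodule 𝒪[E] (Fin 3 → E), IsSelfDualLattice σ ϖ (!![H₂ 0 0, 0, H₂ 0 1; 0, hW, 0; H₂ 1 0, 0, H₂ 1 1] : Matrix (Fin 3) (Fin 3) E) L₃ ∧
          L₃ ⊓ LinearMap.ker ((LinearMap.proj (1 : Fin 3) : (Fin 3 → E) →ₗ[E] E).restrictScalars 𝒪[E]) =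
          B.map ((Matrix.toLin' (!![1, 0; 0, 0; 0, 1] : Matrix (Fin 3) (Fin 2) E)).restrictScalars 𝒪[E]) ∧
          (∀ c : E, (Pi.single 1 c : Fin 3 → E) ∈ L₃ ↔ Valued.v c ≤ Valued.v ϖ ^ b) ∧
          (LatticeNearTransvShell ϖ (d % 2) (mstarOfRecord d) ((((endoGL (γ₂, u) : GL (Fin 3) E) : Matrix (Fin 3) (Fin 3) E) - 1)) L₃ ∧
          {z : E | ∃ y ∈ L₃, Valued.v ((ϖ ^ (mstarOfRecord d))⁻¹ * (z - pairing σ (!![H₂ 0 0, 0, H₂ 0 1; 0, hW, 0; H₂ 1 0, 0, H₂ 1 1] : Matrix (Fin 3) (Fin 3) E) y (((((endoGL (γ₂, u) : GL (Fin 3) E) : Matrix (Fin 3) (Fin 3) E) - 1)) *ᵥ y))) ≤ 1} =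
          valueSetMod σ ϖ (mstarOfRecord d) (xPlus σ ϖ d))}, f b j Λ : ℕ) : ℤ) -
          ((∑ᶠ Λ ∈ levelSetDep ρ Θ α (jE ϖ) h j b (lam - jE ((u : Matrix (Fin 1) (Fin 1) E) 0 0)) ∩
          {Λ | ∃ B : Submodule 𝒪[E] (Fin 2 → E), B.toAddSubgroup.map φ = Λ ∧
          ∃ L₃ : Submodule 𝒪[E] (Fin 3 → E), IsSelfDualLattice σ ϖ (!![H₂ 0 0, 0, H₂ 0 1; 0, hW, 0; H₂ 1 0, 0, H₂ 1 1] : Matrix (Fin 3) (Fin 3) E) L₃ ∧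
          L₃ ⊓ LinearMap.ker ((LinearMap.proj (1 : Fin 3) : (Fin 3 → E) →ₗ[E] E).restrictScalars 𝒪[E]) =
          B.map ((Matrix.toLin' (!![1, 0; 0, 0; 0, 1] : Matrix (Fin 3) (Fin 2) E)).restrictScalars 𝒪[E]) ∧
          (∀ c : E, (Pi.single 1 c : Fin 3 → E) ∈ L₃ ↔ Valued.v c ≤ Valued.v ϖ ^ b) ∧
          (LatticeNearTransvShell ϖ (d % 2) (mcOfRecord d) ((((endoGL (γ₂, u) : GL (Fin 3) E) : Matrix (Fin 3) (Fin 3) E) - 1)) L₃ ∧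
          ¬ {z : E | ∃ y ∈ L₃, Valued.v ((ϖ ^ (mstarOfRecord d))⁻¹ * (z - pairing σ (!![H₂ 0 0, 0, H₂ 0 1; 0, hW, 0; H₂ 1 0, 0, H₂ 1 1] : Matrix (Fin 3) (Fin 3) E) y (((((endoGL (γ₂, u) : GL (Fin 3) E) : Matrix (Fin 3) (Fin 3) E) - 1)) *ᵥ y))) ≤ 1} =
          valueSetMod σ ϖ (mstarOfRecord d) (xPlus σ ϖ d))}, f b j Λ : ℕ) : ℤ) = 0)
    (hOddRow : ∀ j b : ℕ, 1 ≤ b → b ≤ j → d % 2 = 1 → 2 * b + 1 = m → j + b ≤ jl → IsOrd ρ α (jE ϖ ^ j) lam →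
          ((∑ᶠ Λ ∈ levelSetDep ρ Θ α (jE ϖ) h j b (lam - jE ((u : Matrix (Fin 1) (Fin 1) E) 0 0)) ∩
          {Λ | ∃ B : Submodule 𝒪[E] (Fin 2 → E), B.toAddSubgroup.map φ = Λ ∧
          ∃ L₃ : Submodule 𝒪[E] (Fin 3 → E), IsSelfDualLattice σ ϖ (!![H₂ 0 0, 0, H₂ 0 1; 0, hW, 0; H₂ 1 0, 0, H₂ 1 1] : Matrix (Fin 3) (Fin 3) E) L₃ ∧
          L₃ ⊓ LinearMap.ker ((LinearMap.proj (1 : Fin 3) : (Fin 3 → E) →ₗ[E] E).restrictScalars 𝒪[E]) =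
          B.map ((Matrix.toLin' (!![1, 0; 0, 0; 0, 1] : Matrix (Fin 3) (Fin 2) E)).restrictScalars 𝒪[E]) ∧
          (∀ c : E, (Pi.single 1 c : Fin 3 → E) ∈ L₃ ↔ Valued.v c ≤ Valued.v ϖ ^ b) ∧
          (LatticeNearTransvShell ϖ (d % 2) (mstarOfRecord d) ((((endoGL (γ₂, u) : GL (Fin 3) E) : Matrix (Fin 3) (Fin 3) E) - 1)) L₃ ∧
          {z : E | ∃ y ∈ L₃, Valued.v ((ϖ ^ (mstarOfRecord d))⁻¹ * (z - pairing σ (!![H₂ 0 0, 0, H₂ 0 1; 0, hW, 0; H₂ 1 0, 0, H₂ 1 1] : Matrix (Fin 3) (Fin 3) E) y (((((endoGL (γ₂, u) : GL (Fin 3) E) : Matrix (Fin 3) (Fin 3) E) - 1)) *ᵥ y))) ≤ 1} =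
          valueSetMod σ ϖ (mstarOfRecord d) (xPlus σ ϖ d))}, f b j Λ : ℕ) : ℤ) -
          ((∑ᶠ Λ ∈ levelSetDep ρ Θ α (jE ϖ) h j b (lam - jE ((u : Matrix (Fin 1) (Fin 1) E) 0 0)) ∩
          {Λ | ∃ B : Submodule 𝒪[E] (Fin 2 → E), B.toAddSubgroup.map φ = Λ ∧
          ∃ L₃ : Submodule 𝒪[E] (Fin 3 → E), IsSelfDualLattice σ ϖ (!![H₂ 0 0, 0, H₂ 0 1; 0, hW, 0; H₂ 1 0, 0, H₂ 1 1] : Matrix (Fin 3) (Fin 3) E) L₃ ∧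
          L₃ ⊓ LinearMap.ker ((LinearMap.proj (1 : Fin 3) : (Fin 3 → E) →ₗ[E] E).restrictScalars 𝒪[E]) =
          B.map ((Matrix.toLin' (!![1, 0; 0, 0; 0, 1] : Matrix (Fin 3) (Fin 2) E)).restrictScalars 𝒪[E]) ∧
          (∀ c : E, (Pi.single 1 c : Fin 3 → E) ∈ L₃ ↔ Valued.v c ≤ Valued.v ϖ ^ b) ∧
          (LatticeNearTransvShell ϖ (d % 2) (mcOfRecord d) ((((endoGL (γ₂, u) : GL (Fin 3) E) : Matrix (Fin 3) (Fin 3) E) - 1)) L₃ ∧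
          ¬ {z : E | ∃ y ∈ L₃, Valued.v ((ϖ ^ (mstarOfRecord d))⁻¹ * (z - pairing σ (!![H₂ 0 0, 0, H₂ 0 1; 0, hW, 0; H₂ 1 0, 0, H₂ 1 1] : Matrix (Fin 3) (Fin 3) E) y (((((endoGL (γ₂, u) : GL (Fin 3) E) : Matrix (Fin 3) (Fin 3) E) - 1)) *ᵥ y))) ≤ 1} =
          valueSetMod σ ϖ (mstarOfRecord d) (xPlus σ ϖ d))}, f b j Λ : ℕ) : ℤ) = 0)
    (hUlo : ∀ j b : ℕ, 1 ≤ b → b < j → m < 2 * b → j + m = jl + b → mcOfRecord d + 2 * b ≤ 2 * m → IsOrd ρ α (jE ϖ ^ j) lam →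
          ((∑ᶠ Λ ∈ levelSetDep ρ Θ α (jE ϖ) h j b (lam - jE ((u : Matrix (Fin 1) (Fin 1) E) 0 0)) ∩
          {Λ | ∃ B : Submodule 𝒪[E] (Fin 2 → E), B.toAddSubgroup.map φ = Λ ∧
          ∃ L₃ : Submodule 𝒪[E] (Fin 3 → E), IsSelfDualLattice σ ϖ (!![H₂ 0 0, 0, H₂ 0 1; 0, hW, 0; H₂ 1 0, 0, H₂ 1 1] : Matrix (Fin 3) (Fin 3) E) L₃ ∧
          L₃ ⊓ LinearMap.ker ((LinearMap.proj (1 : Fin 3) : (Fin 3 → E) →ₗ[E] E).restrictScalars 𝒪[E]) =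
          B.map ((Matrix.toLin' (!![1, 0; 0, 0; 0, 1] : Matrix (Fin 3) (Fin 2) E)).restrictScalars 𝒪[E]) ∧
          (∀ c : E, (Pi.single 1 c : Fin 3 → E) ∈ L₃ ↔ Valued.v c ≤ Valued.v ϖ ^ b) ∧
          (LatticeNearTransvShell ϖ (d % 2) (mstarOfRecord d) ((((endoGL (γ₂, u) : GL (Fin 3) E) : Matrix (Fin 3) (Fin 3) E) - 1)) L₃ ∧
          {z : E | ∃ y ∈ L₃, Valued.v ((ϖ ^ (mstarOfRecord d))⁻¹ * (z - pairing σ (!![H₂ 0 0, 0, H₂ 0 1; 0, hW, 0; H₂ 1 0, 0, H₂ 1 1] : Matrix (Fin 3) (Fin 3) E) y (((((endoGL (γ₂, u) : GL (Fin 3) E) : Matrix (Fin 3) (Fin 3) E) - 1)) *ᵥ y))) ≤ 1} =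
          valueSetMod σ ϖ (mstarOfRecord d) (xPlus σ ϖ d))}, f b j Λ : ℕ) : ℤ) -
          ((∑ᶠ Λ ∈ levelSetDep ρ Θ α (jE ϖ) h j b (lam - jE ((u : Matrix (Fin 1) (Fin 1) E) 0 0)) ∩
          {Λ | ∃ B : Submodule 𝒪[E] (Fin 2 → E), B.toAddSubgroup.map φ = Λ ∧
          ∃ L₃ : Submodule 𝒪[E] (Fin 3 → E), IsSelfDualLattice σ ϖ (!![H₂ 0 0, 0, H₂ 0 1; 0, hW, 0; H₂ 1 0, 0, H₂ 1 1] : Matrix (Fin 3) (Fin 3) E) L₃ ∧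
          L₃ ⊓ LinearMap.ker ((LinearMap.proj (1 : Fin 3) : (Fin 3 → E) →ₗ[E] E).restrictScalars 𝒪[E]) =
          B.map ((Matrix.toLin' (!![1, 0; 0, 0; 0, 1] : Matrix (Fin 3) (Fin 2) E)).restrictScalars 𝒪[E]) ∧
          (∀ c : E, (Pi.single 1 c : Fin 3 → E) ∈ L₃ ↔ Valued.v c ≤ Valued.v ϖ ^ b) ∧
          (LatticeNearTransvShell ϖ (d % 2) (mcOfRecord d) ((((endoGL (γ₂, u) : GL (Fin 3) E) : Matrix (Fin 3) (Fin 3) E) - 1)) L₃ ∧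
          ¬ {z : E | ∃ y ∈ L₃, Valued.v ((ϖ ^ (mstarOfRecord d))⁻¹ * (z - pairing σ (!![H₂ 0 0, 0, H₂ 0 1; 0, hW, 0; H₂ 1 0, 0, H₂ 1 1] : Matrix (Fin 3) (Fin 3) E) y (((((endoGL (γ₂, u) : GL (Fin 3) E) : Matrix (Fin 3) (Fin 3) E) - 1)) *ᵥ y))) ≤ 1} =
          valueSetMod σ ϖ (mstarOfRecord d) (xPlus σ ϖ d))}, f b j Λ : ℕ) : ℤ) = 0) :
    ∀ b ∈ Finset.Icc 1 R, 2 * b ≠ m → ∀ j ∈ Finset.range (J + 1), IsOrd ρ α (jE ϖ ^ j) lam →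
    ((∑ᶠ Λ ∈ levelSetDep ρ Θ α (jE ϖ) h j b (lam - jE ((u : Matrix (Fin 1) (Fin 1) E) 0 0)) ∩
    {Λ | ∃ B : Submodule 𝒪[E] (Fin 2 → E), B.toAddSubgroup.map φ = Λ ∧
    ∃ L₃ : Submodule 𝒪[E] (Fin 3 → E), IsSelfDualLattice σ ϖ (!![H₂ 0 0, 0, H₂ 0 1; 0, hW, 0; H₂ 1 0, 0, H₂ 1 1] : Matrix (Fin 3) (Fin 3) E) L₃ ∧
    L₃ ⊓ LinearMap.ker ((LinearMap.proj (1 : Fin 3) : (Fin 3 → E) →ₗ[E] E).restrictScalars 𝒪[E]) =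
    B.map ((Matrix.toLin' (!![1, 0; 0, 0; 0, 1] : Matrix (Fin 3) (Fin 2) E)).restrictScalars 𝒪[E]) ∧
    (∀ c : E, (Pi.single 1 c : Fin 3 → E) ∈ L₃ ↔ Valued.v c ≤ Valued.v ϖ ^ b) ∧
    (LatticeNearTransvShell ϖ (d % 2) (mstarOfRecord d) ((((endoGL (γ₂, u) : GL (Fin 3) E) : Matrix (Fin 3) (Fin 3) E) - 1)) L₃ ∧
    {z : E | ∃ y ∈ L₃, Valued.v ((ϖ ^ (mstarOfRecord d))⁻¹ * (z - pairing σ (!![H₂ 0 0, 0, H₂ 0 1; 0, hW, 0; H₂ 1 0, 0, H₂ 1 1] : Matrix (Fin 3) (Fin 3) E) y (((((endoGL (γ₂, u) : GL (Fin 3) E) : Matrix (Fin 3) (Fin 3) E) - 1)) *ᵥ y))) ≤ 1} =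
    valueSetMod σ ϖ (mstarOfRecord d) (xPlus σ ϖ d))}, f b j Λ : ℕ) : ℤ) -
    ((∑ᶠ Λ ∈ levelSetDep ρ Θ α (jE ϖ) h j b (lam - jE ((u : Matrix (Fin 1) (Fin 1) E) 0 0)) ∩
    {Λ | ∃ B : Submodule 𝒪[E] (Fin 2 → E), B.toAddSubgroup.map φ = Λ ∧
    ∃ L₃ : Submodule 𝒪[E] (Fin 3 → E), IsSelfDualLattice σ ϖ (!![H₂ 0 0, 0, H₂ 0 1; 0, hW, 0; H₂ 1 0, 0, H₂ 1 1] : Matrix (Fin 3) (Fin 3) E) L₃ ∧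
    L₃ ⊓ LinearMap.ker ((LinearMap.proj (1 : Fin 3) : (Fin 3 → E) →ₗ[E] E).restrictScalars 𝒪[E]) =
    B.map ((Matrix.toLin' (!![1, 0; 0, 0; 0, 1] : Matrix (Fin 3) (Fin 2) E)).restrictScalars 𝒪[E]) ∧
    (∀ c : E, (Pi.single 1 c : Fin 3 → E) ∈ L₃ ↔ Valued.v c ≤ Valued.v ϖ ^ b) ∧
    (LatticeNearTransvShell ϖ (d % 2) (mcOfRecord d) ((((endoGL (γ₂, u) : GL (Fin 3) E) : Matrix (Fin 3) (Fin 3) E) - 1)) L₃ ∧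
    ¬ {z : E | ∃ y ∈ L₃, Valued.v ((ϖ ^ (mstarOfRecord d))⁻¹ * (z - pairing σ (!![H₂ 0 0, 0, H₂ 0 1; 0, hW, 0; H₂ 1 0, 0, H₂ 1 1] : Matrix (Fin 3) (Fin 3) E) y (((((endoGL (γ₂, u) : GL (Fin 3) E) : Matrix (Fin 3) (Fin 3) E) - 1)) *ᵥ y))) ≤ 1} =
    valueSetMod σ ϖ (mstarOfRecord d) (xPlus σ ϖ d))}, f b j Λ : ℕ) : ℤ) = 0 := by
  -- sizes read off the letters
  obtain ⟨hσ, hvσ, hϖ, -, -, h1d, -⟩ := id _hD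
  have hq : Valued.v (jE ϖ) = exp (-1 : ℤ) := by rw [_hjiso, hϖ]
  have hqpow : ∀ n : ℕ, Valued.v (jE ϖ) ^ n = exp (-(n : ℤ)) := fun n => by
    rw [hq, ← exp_nsmul, nsmul_eq_mul, mul_neg, mul_one]
  have hcc : ∀ n : ℕ, Valued.v (jE ϖ ^ n * (α - ρ α)) = exp (-(n : ℤ)) := fun n => by
    rw [map_mul, _hU, mul_one, map_pow, hqpow]
  have hm1 : d % 2 + 1 ≤ mstarOfRecord d := by unfold mstarOfRecord; omega
  have hsc : mstarOfRecord d ≤ mcOfRecord d := mstarOfRecord_le_mcOfRecord d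
  refine cellDiff_offRowA_eq_zero_of_pieces₄ N σ ϖ d tE _hD _hσσ _h2 jE ρ Θ α lam _hρρ _hvρ _hρj _hjv _hjfix _hΘj _hΘΘ _hΘρ _hvΘ _hα _hα1 _hint _hΘlam _hvlam _hbasis
    _hU _hτ _hσres _hjiso _hq _hddE _hfixE _h2M _hjpow _hEval _hϖmax γ₂ u _hdet _htr _hirr _hlam2 _hρlam m jl _hm _hjl _hs _hp _hNm _hu1N _hlam1 _hu _hum H₂ hW _hH₂ _hH₂σ
    _hhW _hhWσ P₁ _hA _hΓ φ h _hφs _hφi _hφo _hφγ _hform _hΘh _hh J R f _hfinF _hR _hJ _hfinLS _hf ?_ hL ?_ hOddRow ?_ ?_ hUlo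
  · -- `hDeep`: `ℓ₀ + 1` digits deep ⇒ no vertex on either level-`ℓ₀` shell (★ deep-level fold, both pieces `∅`)
    intro j b hb1 hbj h2b h3 hord
    have hμ : Valued.v (lam - jE ((u : Matrix (Fin 1) (Fin 1) E) 0 0)) ≤ Valued.v (jE ϖ) ^ (2 * b + (d % 2 + 1)) := by
      rw [_hm, hqpow, exp_le_exp]; push_cast; omega
    have hanti : Valued.v ((lam - jE ((u : Matrix (Fin 1) (Fin 1) E) 0 0)) - ρ (lam - jE ((u : Matrix (Fin 1) (Fin 1) E) 0 0))) ≤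
        Valued.v (jE ϖ ^ j * (α - ρ α)) * Valued.v (jE ϖ) ^ (b + (d % 2 + 1)) := by
      rw [_hjl, hcc, hqpow, ← exp_add, exp_le_exp]; push_cast; omega
    rw [levelSetDep_inter_shell_eq_empty_of_deep_level σ hσ hvσ hϖ _hH₂ _hH₂σ _hhW jE _hρρ _hvρ _hα _hα1 _hint _hΘΘ _hΘρ _hvΘ _hjv _hjfix _hjpow _hϖmax φ _hφs _hφi _hφo
        _hφγ _hvlam _hΘh _hh _hform u (d % 2) hm1 _hum hb1 hbj hord hμ hanti (mstarOfRecord d) _,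
      levelSetDep_inter_shell_eq_empty_of_deep_level σ hσ hvσ hϖ _hH₂ _hH₂σ _hhW jE _hρρ _hvρ _hα _hα1 _hint _hΘΘ _hΘρ _hvΘ _hjv _hjfix _hjpow _hϖmax φ _hφs _hφi _hφo
        _hφγ _hvlam _hΘh _hh _hform u (d % 2) hm1 _hum hb1 hbj hord hμ hanti (mcOfRecord d) _, finsum_mem_empty]
    simp
  · -- `hL0` (odd `d`): the level-0 anti-diagonal has no vertex on a level-`1` shell (★ antidiagonal fold, both pieces `∅`)
    intro j b hb1 hbj h1 h2b h3 hord
    have hμ : Valued.v (lam - jE ((u : Matrix (Fin 1) (Fin 1) E) 0 0)) ≤ Valued.v (jE ϖ) ^ (2 * b + 1) := by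
      rw [_hm, hqpow, exp_le_exp]; push_cast; omega
    have hanti : Valued.v ((lam - jE ((u : Matrix (Fin 1) (Fin 1) E) 0 0)) - ρ (lam - jE ((u : Matrix (Fin 1) (Fin 1) E) 0 0))) =
        Valued.v (jE ϖ ^ j * (α - ρ α)) * Valued.v (jE ϖ) ^ b := by
      rw [_hjl, hcc, hqpow, ← exp_add]; congr 1; omega
    simp only [h1]
    rw [levelSetDep_inter_shell_eq_empty_of_antidiagonal_one σ hσ hvσ hϖ _hH₂ _hH₂σ _hhW jE _hρρ _hvρ _hα _hα1 _hint _hΘΘ _hΘρ _hvΘ _hjv _hjfix _hjpow _hϖmax φ _hφs _hφi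
        _hφo _hφγ _hvlam _hΘh _hh _hform u hb1 hbj hord hμ hanti (mstarOfRecord d) _,
      levelSetDep_inter_shell_eq_empty_of_antidiagonal_one σ hσ hvσ hϖ _hH₂ _hH₂σ _hhW jE _hρρ _hvρ _hα _hα1 _hint _hΘΘ _hΘρ _hvΘ _hjv _hjfix _hjpow _hϖmax φ _hφs _hφi
        _hφo _hφγ _hvlam _hΘh _hh _hform u hb1 hbj hord hμ hanti (mcOfRecord d) _, finsum_mem_empty]
    simp
  · -- `hUhi`: ★ `cellDiff_top_eq_zero` (`m* ≤ m_c`)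
    intro j b hb1 _hbj _hm2b hline hband hord
    exact cellDiff_top_eq_zero σ _hD _hH₂ _hH₂σ _hhW jE _hρρ _hvρ _hα _hα1 _hint _hΘΘ _hΘρ _hvΘ _hjv _hjfix _hjpow _hϖmax _hjiso _hU φ _hφs _hφi _hφo _hφγ _hvlam
      _hΘh _hh _hform u _hum _hm _hjl f hmcm P₁ _hA _hΓ _hdet _hu _hs _hp j b hb1 hline (by omega) hord
  · -- `hUmid`: ★ `cellDiff_top_eq_zero`
    intro j b hb1 _hbj _hm2b hline _hband1 hband2 hord
    exact cellDiff_top_eq_zero σ _hD _hH₂ _hH₂σ _hhW jE _hρρ _hvρ _hα _hα1 _hint _hΘΘ _hΘρ _hvΘ _hjv _hjfix _hjpow _hϖmax _hjiso _hU φ _hφs _hφi _hφo _hφγ _hvlam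
      _hΘh _hh _hform u _hum _hm _hjl f hmcm P₁ _hA _hΓ _hdet _hu _hs _hp j b hb1 hline hband2 hord

end Summit.HodgeConjecture.HodgeConjecture.Cruxes.H413.F0P3cDyRamBeta2ConesOffRowAOfPiecesResidual

end
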